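import Summits.AnomalousDissipation.AnomalousDissipation.Theses.StirringSphere
import Literature.Analysis.FluidPDE.StatisticalSolutionProofs

/-!
# Line `polar-pin` — crux `StirringSphere.SphereTransfer` (stmt-AnomalousDissipation-17146)

Crux-strategist line (planner-cstrat-stmt-AnomalousDissipation-17146-b1-0, 2026-08-17), registered
as an ALTERNATIVE to `Lines/birth.lean`.

## The observation: the stirring sphere has two pinned poles

The explicit stirring basis `b₀ = sin(2πx₃)e₁ + sin(2πx₁)e₂ + sin(2πx₂)e₃` (`= f_GP`),
`b₁ = cos(2πx₂)e₁ + cos(2πx₃)e₂ + cos(2πx₁)e₃`, `b₂ = Σᵢ sin 2π(x_{i+1}+x_{i+2}) eᵢ` carries the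
Klein four-group `G = {1, τ, P, Pτ}` of EXACT symmetries of the Navier–Stokes equations on `T³`:
`τ` = translation by `(½,½,½)` and `P` = parity `(Pu)(x) = −u(−x)`. On the basis:
`τb₀ = −b₀, τb₁ = −b₁, τb₂ = b₂` (shell `|k|₁ = 1` odd, shell `(0,1,1)` even) and
`Pb₀ = b₀, Pb₁ = −b₁, Pb₂ = b₂` (sines are `P`-even, cosines `P`-odd). Hence the POLAR force
`f_{e₂} = b₂` is `G`-invariant, `G` acts on the force sphere as `(c₀,c₁,c₂) ↦ (±c₀, ±c₁, c₂)`, and for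
every Foias–Prodi stationary statistical solution `μ` of `NS_ν(b₂)` the `G`-average
`μ̄ = ¼ Σ_g g_#μ` is again a stationary statistical solution of `NS_ν(b₂)` with the SAME mean energy
and the SAME injection `∫(u,b₂)`, but with `∫(u,b₀)dμ̄ = ∫(u,b₁)dμ̄ = 0`: its mean-flow response
`y(μ̄) ∈ ℝ³` is ALIGNED with the pole `e₂` — no hairy ball needed, and the aligned force does NOT
wander with `ν`.

Consequently the route's own cruxes `NoScreening` (17144: `|y(μ)| ≥ m₀` for all bounded statistics
of every `f_c`, ν-uniformly) and `BoundedSphereStatistics` (17145: bounded statistics exist for every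
`f_c`, ν-uniformly), SPECIALISED TO THE POLE, already produce bounded statistics of the FIXED force
`b₂` with injection `≥ m₀` at every small `ν` (theorem `stub_polarCore_of_route` below, proved). The
first of the crux's two conceded open transfers — "the aligned point may wander on S², inviscid
statistics need not be upper-hemicontinuous in the force" (`birth`'s XL heart
`stub_forceEquicontinuity`, species `Literature.Barriers.AnomalousDissipation.ForceRobustNoAnomalyNarrow`)
— is therefore UNNECESSARY for the route: only the second transfer (injection floor ⇒ dissipation
floor: no ensemble leakage), for the single force `b₂`, remains.

## The line (three registered stubs; composition and the route reduction PROVED)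

* `stub_polarPin` (PROVABLE NOW, size L: the symmetrisation lemma; new torus plumbing = the action of
  `τ_{(½,½,½)}` and `P` on `H` as measurable linear isometries, push-forward of
  `IsStationaryStatisticalSolution` under a symmetry fixing the force — pattern:
  `Theorems/TameRoughRigidityTameClosureSymmetrise.lean` / `…Desaturation.lean`, which do exactly this
  for `u ↦ −u` at `ν = 0` — and convexity of the Foias–Prodi class). For every `ν > 0` and every
  stationary statistical solution `μ` of `NS_ν(b₂)` with integrable energy there is a stationary
  statistical solution `μ'` of `NS_ν(b₂)` with integrable energy, the same `ensembleEnergy`, the same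
  injection `∫(u,b₂)`, and `∫(u,b₀)dμ' = ∫(u,b₁)dμ' = 0`.
* `stub_polarCore` (the polar shadow of cruxes 17144 + 17145; PROVED from them in this file,
  `stub_polarCore_of_route : NoScreening → BoundedSphereStatistics → Sig.stub_polarCore`, so it adds
  NOTHING to the route's cone; standalone it is strictly weaker than either: ONE force, boundedness
  existential, non-screening asked only of ALIGNED statistics). There are `E, ν₀, m₀ > 0` such that
  for `ν ∈ (0,ν₀)`: (i) `NS_ν(b₂)` has a stationary statistical solution with integrable energy
  `≤ E`; (ii) every stationary statistical solution of `NS_ν(b₂)` with integrable energy `≤ E` and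
  `∫(u,b₀) = ∫(u,b₁) = 0` injects `∫(u,b₂) ≥ m₀`.
* `stub_polarNoLeak` (OPEN; the `c`-CONSTANT special case of the crux at the pole = no ensemble
  leakage for the single force `b₂`, in the weakest form the target accepts: existential statistics,
  one force, along a sequence). If for some `E, ν₀, m₀ > 0` every `ν ∈ (0,ν₀)` carries a stationary
  statistical solution of `NS_ν(b₂)` with integrable energy `≤ E` and injection `≥ m₀`, then `b₂`
  obeys the ensemble zeroth law: stationary statistics along `ν_j → 0` with bounded energy and
  ensemble DISSIPATION `≥ ε > 0`. Implied by `birth`'s `stub_noEnsembleLeakage` (3-D mean energy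
  equation for all Foias–Prodi statistics of the sphere forces); true in `d = 2`
  (`Torus.IsStationaryStatisticalSolution.energy_eq_holds`); holds for Dirac statistics at steady
  states and V-bounded-supported statistics. Why it might fail: leaky diffuse Foias–Prodi statistics
  at fixed `ν` with no constructive way to replace them (then the route restates its cruxes over a
  leak-free class — steady states / balanced statistics — upstream).
* `SphereTransfer_of : Sig.stub_polarPin → Sig.stub_polarCore → Sig.stub_polarNoLeak → SphereTransfer`
  (PROVED, no `sorry`): bounded statistics at the pole (Core (i)) ↦ `G`-symmetrised, aligned, same
  energy and injection (Pin) ↦ injection `≥ m₀` (Core (ii)) ↦ ensemble zeroth law at `b₂` (NoLeak) ↦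
  `SphereEnsembleZerothLaw` with `c⋆ = e₂` ↦ the crux BY NAME. The crux's own hypothesis (aligned loud
  statistics of a ν-DEPENDENT force `c_ν`) is deliberately NOT used: it is the wrong interface — the
  symmetry supplies a ν-INDEPENDENT aligned force, so nothing has to be transferred across forces.

Route-level consequence (for the tenure planner; recorded, not enacted here): `closes` can be re-glued
as `NoScreening → BoundedSphereStatistics → PolarPin → PolarTransfer → EnsembleRealization →
AnomalousDissipation` with `PolarPin := Sig.stub_polarPin` (support, provable now) and
`PolarTransfer := Sig.stub_polarNoLeak` (crux); `HairyBallAlignment` (17155) and `SphereTransfer`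
(17146) leave the cone. No lead should be seated on the wandering-force transfer.

## Disproof / negatives honoured

No `Cruxes/SphereTransfer/Disproof.lean` exists (2026-08-17). Negatives index (14324, 0204, 13037,
2979, 2984, 2859): no stub is an instance (energy levels bound existentially chosen statistics on the
mean-zero space `H`; 2984's non-zero-mean Galilean witness does not touch statements over statistics).

References: FMRTTurbulence2001 Ch. IV §1.2 Def. 1.3 (1.29)–(1.31), Ch. V §1; DoeringFoias2002 §2;
Frisch1995 §7 (symmetries of NS restored statistically); Cheskidov2023 §1.2 (the barrier this line no
longer meets); Milnor1978 (the route's lever, shown redundant at the poles).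
-/

set_option linter.dupNamespace false

noncomputable section

namespace Summit.AnomalousDissipation.AnomalousDissipation.Cruxes.SphereTransfer.PolarPin

open MeasureTheory Set Filter Topology
open Literature.Analysis Literature.Analysis.FluidPDE
open Summit.AnomalousDissipation.AnomalousDissipation.Theses.StirringSphere

local notation "𝕋³" => UnitAddTorus (Fin 3)
local notation "E³" => EuclideanSpace ℝ (Fin 3)
local notation "H³" => FunctionSpaces.Torus.energySpace (Fin 3)
local notation "L2T³" => Lp (EuclideanSpace ℝ (Fin 3)) 2 (volume : Measure (UnitAddTorus (Fin 3)))

/-! ### §0 Vocabulary (transparent abbreviations of the route's verbatim sub-terms) -/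

/-- The explicit stirring basis `(b₀, b₁, b₂)` — verbatim the route's `![…]`. -/
abbrev stirBasis : Fin 3 → 𝕋³ → E³ :=
  ![(fun x : UnitAddTorus (Fin 3) => (Literature.Analysis.FluidPDE.Torus.stokesMode (Pi.single (2 : Fin 3) (1 : ℤ)) (EuclideanSpace.single (0 : Fin 3) (1 : ℝ)) false x + Literature.Analysis.FluidPDE.Torus.stokesMode (Pi.single (0 : Fin 3) (1 : ℤ)) (EuclideanSpace.single (1 : Fin 3) (1 : ℝ)) false x + Literature.Analysis.FluidPDE.Torus.stokesMode (Pi.single (1 : Fin 3) (1 : ℤ)) (EuclideanSpace.single (2 : Fin 3) (1 : ℝ)) false x : EuclideanSpace ℝ (Fin 3))), (fun x : UnitAddTorus (Fin 3) => (Literature.Analysis.FluidPDE.Torus.stokesMode (Pi.single (1 : Fin 3) (1 : ℤ)) (EuclideanSpace.single (0 : Fin 3) (1 : ℝ)) true x + Literature.Analysis.FluidPDE.Torus.stokesMode (Pi.single (2 : Fin 3) (1 : ℤ)) (EuclideanSpace.single (1 : Fin 3) (1 : ℝ)) true x + Literature.Analysis.FluidPDE.Torus.stokesMode (Pi.single (0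 : Fin 3) (1 : ℤ)) (EuclideanSpace.single (2 : Fin 3) (1 : ℝ)) true x : EuclideanSpace ℝ (Fin 3))), (fun x : UnitAddTorus (Fin 3) => (Literature.Analysis.FluidPDE.Torus.stokesMode ![(0 : ℤ), 1, 1] (EuclideanSpace.single (0 : Fin 3) (1 : ℝ)) false x + Literature.Analysis.FluidPDE.Torus.stokesMode ![(1 : ℤ), 0, 1] (EuclideanSpace.single (1 : Fin 3) (1 : ℝ)) false x + Literature.Analysis.FluidPDE.Torus.stokesMode ![(1 : ℤ), 1, 0] (EuclideanSpace.single (2 : Fin 3) (1 : ℝ)) false x : EuclideanSpace ℝ (Fin 3)))]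

/-- The force `f_c = Σ cᵢ bᵢ` of the stirring family (verbatim the route's lambda). -/
abbrev force (b : Fin 3 → 𝕋³ → E³) (c : E³) : 𝕋³ → E³ :=
  fun x : UnitAddTorus (Fin 3) => ∑ i : Fin 3, c i • b i x

/-- The pole `e₂` of the force sphere (unit vector; `f_{e₂} = b₂`). -/
abbrev pole : E³ := EuclideanSpace.single (2 : Fin 3) (1 : ℝ)

/-- Ensemble pairing `∫ (u, g) dμ(u)` of a statistics `μ` against a field `g` (the injection when
`g` is the force; the mean-flow response component `yᵢ(μ)` when `g = bᵢ`). -/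
abbrev injection (μ : Measure H³) (g : 𝕋³ → E³) : ℝ :=
  ∫ u, Torus.pairing ((u : H³) : L2T³) g ∂μ

/-! ### §1 Signatures of the registered stubs -/

/-- STUB 1 — **POLAR PIN (Klein-four symmetrisation; PROVABLE NOW, L).** For every `ν > 0` and every
Foias–Prodi stationary statistical solution `μ` of `NS_ν(b₂)` with integrable energy there is a
stationary statistical solution `μ'` of `NS_ν(b₂)` with integrable energy, the same mean energy, the
same injection `∫(u,b₂)`, and vanishing off-polar responses `∫(u,b₀)dμ' = ∫(u,b₁)dμ' = 0`. Witness: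
`μ' = ¼ (μ + τ_#μ + P_#μ + (Pτ)_#μ)`, `τ` = translation by `(½,½,½)`, `P u = −u(−·)`; both are linear
isometries of `H` commuting with `NS_ν` and fixing `b₂`, with `τb₀ = −b₀, τb₁ = −b₁, Pb₀ = b₀,
Pb₁ = −b₁`; the Foias–Prodi class is convex and closed under push-forward by a force-fixing symmetry
(cylindrical tests map to cylindrical tests, shells and the spectral enstrophy are invariant).
Sources: FMRTTurbulence2001 Ch. IV Def. 1.3; Frisch1995 §7; tree pattern
`TameRoughRigidityTameClosureSymmetrise.stub_symmetrise`. -/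
def Sig.stub_polarPin : Prop :=
  ∀ b : Fin 3 → 𝕋³ → E³, b = stirBasis →
  ∀ ν : ℝ, 0 < ν → ∀ μ : Measure H³,
    Torus.IsStationaryStatisticalSolution ν (force b pole) μ →
    Integrable (fun u : H³ => ‖u‖ ^ 2) μ →
    ∃ μ' : Measure H³,
      Torus.IsStationaryStatisticalSolution ν (force b pole) μ' ∧
      Integrable (fun u : H³ => ‖u‖ ^ 2) μ' ∧
      Torus.ensembleEnergy μ' = Torus.ensembleEnergy μ ∧
      injection μ' (force b pole) = injection μ (force b pole) ∧
      injection μ' (b 0) = 0 ∧ injection μ' (b 1) = 0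

/-- STUB 2 — **POLAR CORE (the polar shadow of `NoScreening` + `BoundedSphereStatistics`; implied by
them — `stub_polarCore_of_route` below — hence free in the route's cone).** There are `E, ν₀, m₀ > 0`
such that for every `ν ∈ (0, ν₀)`: (i) `NS_ν(b₂)` admits a stationary statistical solution with
integrable mean energy `≤ E`; (ii) every stationary statistical solution of `NS_ν(b₂)` with
integrable mean energy `≤ E` whose responses on `b₀, b₁` vanish injects `∫(u,b₂) ≥ m₀`. Why it
might fail standalone: `b₂` may be laminar-prone (runaway statistics only) or admit bounded aligned
statistics that are quiet — exactly the polar instances of the failure modes of cruxes 17145 / 17144.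
Sources: FMRTTurbulence2001 Ch. IV–V, DoeringFoias2002 §2, the route header (StirringSphere rev 4). -/
def Sig.stub_polarCore : Prop :=
  ∀ b : Fin 3 → 𝕋³ → E³, b = stirBasis →
  ∃ E ν₀ m₀ : ℝ, 0 < E ∧ 0 < ν₀ ∧ 0 < m₀ ∧
    ∀ ν : ℝ, 0 < ν → ν < ν₀ →
      (∃ μ : Measure H³,
        Torus.IsStationaryStatisticalSolution ν (force b pole) μ ∧
        Integrable (fun u : H³ => ‖u‖ ^ 2) μ ∧
        Torus.ensembleEnergy μ ≤ E) ∧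
      (∀ μ : Measure H³,
        Torus.IsStationaryStatisticalSolution ν (force b pole) μ →
        Integrable (fun u : H³ => ‖u‖ ^ 2) μ →
        Torus.ensembleEnergy μ ≤ E →
        injection μ (b 0) = 0 → injection μ (b 1) = 0 →
        m₀ ≤ injection μ (force b pole))

/-- STUB 3 — **POLAR NO-LEAK (OPEN; the `c`-constant special case of the crux at the pole).** If for
some `E, ν₀, m₀ > 0` every `ν ∈ (0, ν₀)` carries a stationary statistical solution of `NS_ν(b₂)`
with integrable mean energy `≤ E` and injection `∫(u,b₂) ≥ m₀`, then `b₂` obeys the ensemble zeroth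
law: viscosities `ν_j → 0` and stationary statistical solutions `μ_j` of `NS_{ν_j}(b₂)` with
integrable, uniformly bounded mean energy and `ensembleDissipation ν_j μ_j ≥ ε > 0`. Content = no
ensemble leakage (injection floor ⇒ viscous-dissipation floor for SOME statistics of the same force):
true in `d = 2` (`energy_eq_holds`), for Dirac statistics at steady states and V-bounded-supported
statistics; implied by `birth`'s `stub_noEnsembleLeakage`. Why it might fail: leaky diffuse
Foias–Prodi statistics at fixed `ν` (FMRT IV (1.31) is an inequality in `d = 3`) and no constructive
way to replace them. Sources: FMRTTurbulence2001 Ch. IV Def. 1.3 / Thm. 2.2, DoeringFoias2002 §2,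
FoiasRosaTemam2019, DuchonRobert2000. -/
def Sig.stub_polarNoLeak : Prop :=
  ∀ b : Fin 3 → 𝕋³ → E³, b = stirBasis →
  ∀ E ν₀ m₀ : ℝ, 0 < E → 0 < ν₀ → 0 < m₀ →
    (∀ ν : ℝ, 0 < ν → ν < ν₀ → ∃ μ : Measure H³,
      Torus.IsStationaryStatisticalSolution ν (force b pole) μ ∧
      Integrable (fun u : H³ => ‖u‖ ^ 2) μ ∧
      Torus.ensembleEnergy μ ≤ E ∧
      m₀ ≤ injection μ (force b pole)) →
    ∃ (νs : ℕ → ℝ) (μs : ℕ → Measure H³),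
      (∀ j, 0 < νs j) ∧ Tendsto νs atTop (𝓝 0) ∧
      (∀ j, Torus.IsStationaryStatisticalSolution (νs j) (force b pole) (μs j)) ∧
      (∀ j, Integrable (fun u : H³ => ‖u‖ ^ 2) (μs j)) ∧
      (∃ E' : ℝ, ∀ j, Torus.ensembleEnergy (μs j) ≤ E') ∧
      ∃ ε : ℝ, 0 < ε ∧ ∀ j, ε ≤ Torus.ensembleDissipation (νs j) (μs j)

/-! ### §2 Registered stubs (the only `sorry`s of the file) -/

/-- Registered stub 1 — polar pin (Klein-four symmetrisation at the pole; provable now). -/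
theorem stub_polarPin : Sig.stub_polarPin := by
  sorry

/-- Registered stub 2 — polar core (bounded statistics exist at the pole; aligned bounded polar
statistics are loud). Closed for free from `NoScreening` + `BoundedSphereStatistics` by
`stub_polarCore_of_route`. -/
theorem stub_polarCore : Sig.stub_polarCore := by
  sorry

/-- Registered stub 3 — polar no-leak (the hardest stub; open). -/
theorem stub_polarNoLeak : Sig.stub_polarNoLeak := by
  sorry

/-! ### §3 Elementary facts about the pole -/

/-- The pole is a unit vector. -/
theorem norm_pole : ‖pole‖ = 1 := by
  simp [pole]

/-- The polar force is the third basis field: `Σᵢ (e₂)ᵢ bᵢ = b₂`. -/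
theorem force_pole_eq (b : Fin 3 → 𝕋³ → E³) : force b pole = b 2 := by
  funext x
  simp [force, pole]

/-- Every force of the stirring family is smooth (finite sum of scalar multiples of Stokes modes). -/
theorem isSmooth_force (b : Fin 3 → 𝕋³ → E³) (hb : b = stirBasis) (c : E³) :
    FunctionSpaces.Torus.IsSmooth (force b c) := by
  subst hb
  have hs : ∀ i : Fin 3, FunctionSpaces.Torus.IsSmooth (stirBasis i) := by
    intro i
    fin_cases i
    · exact ((Torus.isSmooth_stokesMode _ _ _).add (Torus.isSmooth_stokesMode _ _ _)).add
        (Torus.isSmooth_stokesMode _ _ _)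
    · exact ((Torus.isSmooth_stokesMode _ _ _).add (Torus.isSmooth_stokesMode _ _ _)).add
        (Torus.isSmooth_stokesMode _ _ _)
    · exact ((Torus.isSmooth_stokesMode _ _ _).add (Torus.isSmooth_stokesMode _ _ _)).add
        (Torus.isSmooth_stokesMode _ _ _)
  have h : force stirBasis c =
      fun x => c 0 • stirBasis 0 x + c 1 • stirBasis 1 x + c 2 • stirBasis 2 x := by
    funext x
    simp only [force, Fin.sum_univ_three]
  rw [h]
  exact (((hs 0).smul (c 0)).add ((hs 1).smul (c 1))).add ((hs 2).smul (c 2))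

/-! ### §4 The polar core is implied by the route's cruxes 17144 + 17145 (proved) -/

/-- **`stub_polarCore` is free in the route's cone**: `NoScreening → BoundedSphereStatistics →
Sig.stub_polarCore`. Specialise both cruxes to `c = e₂`; for an aligned statistics (`y₀ = y₁ = 0`)
the non-screening bound `m₀² ≤ y₀² + y₁² + y₂²` reads `m₀² ≤ y₂²`, and `y₂ = ∫(u,b₂) ≥ ν·(mean
enstrophy) ≥ 0` by the Foias–Prodi energy inequality (`energy_le_holds`), so `y₂ ≥ m₀`. -/
theorem stub_polarCore_of_route : NoScreening → BoundedSphereStatistics → Sig.stub_polarCore := by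
  intro hNS hB b hb
  obtain ⟨E, ν₀, hE, hν₀, hbdd⟩ := hB b hb
  obtain ⟨ν₁, m₀, hν₁, hm₀, hns⟩ := hNS b hb E hE
  refine ⟨E, min ν₀ ν₁, m₀, hE, lt_min hν₀ hν₁, hm₀, fun ν hν hνlt => ⟨?_, ?_⟩⟩
  · obtain ⟨μ, hstat, hint, hEμ⟩ := hbdd pole norm_pole ν hν (hνlt.trans_le (min_le_left _ _))
    exact ⟨μ, hstat, hint, hEμ⟩
  · intro μ hstat hint hEμ h0 h1
    have hsq := hns pole norm_pole ν hν (hνlt.trans_le (min_le_right _ _)) μ hstat hint hEμ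
    have h0' : (∫ u, Torus.pairing ((u : H³) : L2T³) (b 0) ∂μ) = 0 := h0
    have h1' : (∫ u, Torus.pairing ((u : H³) : L2T³) (b 1) ∂μ) = 0 := h1
    have h2 : (∫ u, Torus.pairing ((u : H³) : L2T³) (b 2) ∂μ) = injection μ (force b pole) := by
      rw [force_pole_eq]
    rw [Fin.sum_univ_three, h0', h1', h2] at hsq
    -- the sign of the injection: Foias–Prodi energy inequality
    have hf2 : MemLp (force b pole) 2 volume := (isSmooth_force b hb pole).memLp 2
    have hle := Torus.IsStationaryStatisticalSolution.energy_le_holds hstat hf2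
    have hnn : 0 ≤ injection μ (force b pole) :=
      le_trans (mul_nonneg hν.le ENNReal.toReal_nonneg) hle
    nlinarith [hsq, hnn, hm₀]

/-! ### §5 Composition (kernel-checked; no `sorry` outside the three stubs) -/

/-- Loud bounded statistics of the FIXED polar force at every small viscosity, from Pin + Core. -/
theorem polarLoud_of (hP : Sig.stub_polarPin) (hC : Sig.stub_polarCore)
    (b : Fin 3 → 𝕋³ → E³) (hb : b = stirBasis) :
    ∃ E ν₀ m₀ : ℝ, 0 < E ∧ 0 < ν₀ ∧ 0 < m₀ ∧
      ∀ ν : ℝ, 0 < ν → ν < ν₀ → ∃ μ : Measure H³,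
        Torus.IsStationaryStatisticalSolution ν (force b pole) μ ∧
        Integrable (fun u : H³ => ‖u‖ ^ 2) μ ∧
        Torus.ensembleEnergy μ ≤ E ∧
        m₀ ≤ injection μ (force b pole) := by
  obtain ⟨E, ν₀, m₀, hE, hν₀, hm₀, h⟩ := hC b hb
  refine ⟨E, ν₀, m₀, hE, hν₀, hm₀, fun ν hν hνlt => ?_⟩
  obtain ⟨⟨μ, hstat, hint, hEμ⟩, hfloor⟩ := h ν hν hνlt
  obtain ⟨μ', hstat', hint', hEeq, _hinj, h0, h1⟩ := hP b hb ν hν μ hstat hint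
  exact ⟨μ', hstat', hint', hEeq.trans_le hEμ, hfloor μ' hstat' hint' (hEeq.trans_le hEμ) h0 h1⟩

/-- **The skeleton closes the crux BY NAME**:
`Sig.stub_polarPin → Sig.stub_polarCore → Sig.stub_polarNoLeak → StirringSphere.SphereTransfer`.
Bounded polar statistics (Core i) are symmetrised into aligned ones with the same energy and
injection (Pin), which are loud (Core ii); no-leak at the pole gives the ensemble zeroth law for `b₂`,
i.e. `SphereEnsembleZerothLaw` with `c⋆ = e₂`, under the crux's binder `b = ![…]` (`subst`). The crux's
aligned-loud hypothesis is not used (the symmetry pins the aligned force; nothing wanders). -/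
theorem SphereTransfer_of :
    Sig.stub_polarPin → Sig.stub_polarCore → Sig.stub_polarNoLeak → SphereTransfer := by
  intro hP hC hL b hb E ν₀ m₀ _hE _hν₀ _hm₀ _hal
  obtain ⟨E₁, ν₁, m₁, hE₁, hν₁, hm₁, hloud⟩ := polarLoud_of hP hC b hb
  obtain ⟨νs, μs, hpos, htend, hstat, hint, hbd, ε, hε, hdiss⟩ :=
    hL b hb E₁ ν₁ m₁ hE₁ hν₁ hm₁ hloud
  intro b' hb'
  have hbb : b' = b := hb'.trans hb.symm
  subst hbb
  exact ⟨pole, norm_pole, νs, μs, hpos, htend, hstat, hint, hbd, ε, hε, hdiss⟩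

/-- **The crux inside the route's cone**: given the route's own cruxes `NoScreening` (17144) and
`BoundedSphereStatistics` (17145) — both hypotheses of `closes` anyway — the crux needs only the
symmetrisation lemma (Pin, provable now) and no-leak at the pole: the wandering-force transfer and the
hairy ball are bypassed. Kernel-checked composition of `stub_polarCore_of_route` with
`SphereTransfer_of`. -/
theorem SphereTransfer_of_route :
    Sig.stub_polarPin → NoScreening → BoundedSphereStatistics → Sig.stub_polarNoLeak →
      SphereTransfer :=
  fun hP hNS hB hL => SphereTransfer_of hP (stub_polarCore_of_route hNS hB) hL

/-- The skeleton in its final shape (D-0027 §3.3): the crux BY NAME from the three registered stubs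
(depends on `sorryAx` through the stubs only). -/
theorem SphereTransfer_proof : SphereTransfer :=
  SphereTransfer_of stub_polarPin stub_polarCore stub_polarNoLeak

end Summit.AnomalousDissipation.AnomalousDissipation.Cruxes.SphereTransfer.PolarPin

end
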